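import Summits.BirchSwinnertonDyer.BirchSwinnertonDyer.Theses.UniversalToricDescent
import Summits.BirchSwinnertonDyer.BirchSwinnertonDyer.Theorems.UniversalToricDescentTwinAlgMuZeroAtThreeOfBetaRoadParam
import Summits.BirchSwinnertonDyer.BirchSwinnertonDyer.Theorems.UniversalToricDescentBetaRoadParamDefs
import Literature.Barriers.BirchSwinnertonDyer.AnticyclotomicHeightDegeneracy
import Mathlib.NumberTheory.LSeries.PrimesInAP
import Mathlib.NumberTheory.LegendreSymbol.JacobiSymbol
import HarnessLib

/-!
# Line `half_plectic_transverse` — row 27 (crux-ideate g18) for `UniversalToricDescent.TwinAlgMuZeroAtThree`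

Crux item `stmt-BirchSwinnertonDyer-24737`; LEAD skeleton `Lines/beta_road.lean` v19 (K1‴ → K2a‴ → C₀′ → crux, composition
`twinAlgMuZeroAtThree_of_betaRoadParamStubs`, p776836).  This node is a NEW SUPPLIER for the bucket-B local slot **K1‴**
(`PrincipalHeegnerIndivisibleMultOfParamAtThree`: some principal layer Heegner point `z_k` is not `3·`(a point fixed by
`Γ_{K_k} ⊓ D_𝔭`)), technique-differentiated from rows 1–26: it reads K1‴ off the **`K′`-transverse derivative of a
discriminant-one totally definite theta element over an even-degree real quadratic base change**.

## THE MOVE (half-plectic transverse derivative)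

Data forced by the crux: `E′/ℚ` bucket B (`3 ∥ N′`, très ramifié), `ρ̄₃` onto, `K` Heegner for `N′`, `d_K` odd, `3 = 𝔭𝔭′`
split in `K`, `κ` the anticyclotomic `ℤ₃`-extension, `Γ_K = Gal(K_∞/K)`, `Λ_K = ℤ₃⟦Γ_K⟧`.

1. PARTNER (typed & PROVED below, `partnerPrimeSupply`): a prime `ℓ ≡ 5 (mod 12)`, `ℓ ∤ N′ d_K`, `(d_K/ℓ) = 1`.  Put
   `F = ℚ(√ℓ)` (real; `3` INERT in `F`; `F/ℚ` unramified at `3 N′ d_K`), `L = K·F` (CM biquadratic), `K′ = ℚ(√(ℓ d_K))`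
   (imaginary; `3` inert in `K′`; `ℓ` split in `K` ⇒ `K` is Heegner for `N′ℓ²`, the conductor of the twist `E′^{(ℓ)}`, which
   is again bucket B with `ρ̄₃` onto — twisting by `ℚ(√ℓ)` is unramified at `3`).
2. UPSTAIRS OBJECT: `[F:ℚ] = 2` is even, so the totally definite quaternion algebra `B/F` of discriminant `1` exists; every
   `q ∣ N′` splits in `K`, hence in `L/F`; so for ring-class characters `χ_L` of `L` of `3`-power conductor the pair
   `(f_F, χ_L)` is DEFINITE (sign `+1`) and Gross points of conductor `3ⁿ𝒪_F` on the class set of an Eichler order of level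
   `N′𝒪_F` in `B` (`3𝒪_F ∥ N′𝒪_F`, `3𝒪_F` split in `L`: condition (ord) holds) give an INTEGRAL two-variable theta element
   `θ_L ∈ ℤ₃⟦Γ_K × Γ_{K′}⟧` (the anticyclotomic `ℤ₃²`-extension of `L` is `L K_∞ K′_∞`).  No Shimura curve, no ERL, no
   BDP denominator at `3`, no admissible / level-raising prime.
3. K-LINE IS EXCEPTIONAL (Artin formalism): for `χ` a character of `Γ_K`,
   `L(E′/L, χ∘N_{L/K}, s) = L(E′/K, χ, s) · L(E′^{(ℓ)}/K, χ, s)`, both factors of sign `−1` (Heegner for `N′` and `N′ℓ²`),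
   so `θ_L ↦ 0` under `Λ_L → Λ_K`: `θ_L = u · θ′`, `u = γ_{K′} − 1`.  TRANSVERSE DERIVATIVE `θ_L^{(1)} := θ′|_{Γ_K} ∈ Λ_K`.
4. (α) TRANSVERSE MULTIPLICITY ONE mod 3: `μ(θ_L^{(1)}) = 0`, i.e. `θ_L mod 3 ∉ u²·𝔽₃⟦Γ_K × Γ_{K′}⟧`; by the instrument
   `transverse_mult_one_iff` this says: at some finite layer the three `K′`-cells above one `K`-cell have Gross-point sums NOT
   all congruent mod `3` (a Vatsal / Cornut–Vatsal uniform-distribution statement on a finite class set over `F`).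
5. (β) HALF-PLECTIC `Λ_K`-ADIC GROSS–ZAGIER: `θ_L^{(1)} ≐ ⟨z_∞(E′), z_∞(E′^{(ℓ)})⟩_{K′}` — the `K′`-direction `Λ_K`-adic
   height (Nekovář Selmer-complex height for the `ℤ₃`-direction `Γ_{K′}` of `L K_∞ K′_∞ / L K_∞`) between the Heegner family
   of `E′` along `K_∞` (`= E′(L K_k)^{a=+1}`) and that of the twist (`E′^{(ℓ)}(K_k) = E′(L K_k)^{a=−1}`, `a` generating
   `Gal(L/K)`).  The height is ANTI-equivariant under `a` (which inverts `Γ_{K′}`), so `(+,+)` and `(−,−)` vanish and the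
   Gram matrix of the balanced pair is anti-diagonal with determinant `−h·h^t` (instrument `gram_balanced`): parity is
   BALANCED (`r₊ = r₋ = 1`), the exact configuration in which `AnticyclotomicHeightDegeneracy` forces nothing.
6. (γ) LOCAL EXTRACTION: the `K′`-logarithm is anticyclotomic for `K′`, `3` is inert in `K′`, so `ℓ_{K′,w}` kills `ℚ₃^×`
   and in particular the Tate period of `E′` at `w ∣ 3` (no exceptional-zero correction in the transverse direction); the
   height is a sum of `ℤ₃`-valued bilinear LOCAL terms at the two primes `w ∣ 𝔭`, `w′ ∣ 𝔭′` of `L K_k` (terms away from `3`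
   vanish for unramified conditions; Tamagawa contributions are bounded, `μ`-invisible), swapped by complex conjugation; so
   `μ(height) = 0` ⇒ at some layer `k` the `𝔭`-side local term of `(z_k, g·y_k)` is a `3`-adic unit ⇒ `z_k ∉ 3·E′((L K_k)_w)`
   `⊇ 3·E′((K_k)_𝔭)` (instrument `local_extraction`) — this is K1‴'s conclusion BY NAME, and it persists to all `k′ ≥ k`.
7. K1‴ + K2a‴ (BY NAME) + C₀′ (BY NAME) ⇒ crux, via `twinAlgMuZeroAtThree_of_betaRoadParamStubs`.

## PIECES and TAGS (typed pieces are decls of this file; untyped ones are definition-blocked)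

* P1 `PartnerPrimeSupply` — typed, **PROVED** (`partnerPrimeSupply`: Dirichlet + CRT + Jacobi periodicity).  ATTACKABLE ✓ done.
* (α) transverse multiplicity one mod 3 — **UNDECIDED·research**, untyped (needs D1 = Gross points / theta elements of a
  totally definite quaternion algebra over a totally real `F`); finite-layer content kernel-checked as `transverse_mult_one_iff`.
  Leaf: INSTRUMENTABLE (Magma `BrandtModule` over `F = ℚ(√17)`, Eichler level `15𝒪_F`, CM points by `L = F(√−59)` of
  conductor `3ⁿ𝒪_F`, for `E′ = 15a1`, `K = ℚ(√−59)`, partner `ℓ = 17`: test the cell criterion mod `3`) / port of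
  Cornut–Vatsal over `F`.
* (β) half-plectic `Λ`-adic Gross–Zagier — **IDEA-NEEDED·research**, untyped (needs D2 = Nekovář height in a general
  `ℤ_p`-direction; D1).  Unprinted; nearest print: Bertolini–Darmon 1998 `θ′ =` Heegner point (one variable), Howard 2005
  `Λ`-adic GZ, Darmon–Fornea mock plectic points (`p` inert in `K`, first derivatives of two-variable families), Fornea–Gehrmann
  plectic Artin formalism, Disegni universal `p`-adic GZ.  Leaf: IDEA-NEEDED.
* (γ) local extraction — **UNDECIDED** (standard shape), untyped as a whole (needs D3 = `ℓ`-local height symbols at split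
  multiplicative primes); its algebraic skeleton is kernel-checked (`local_extraction`, `norm_lt_one_of_three_smul`).  Leaf: ATTACKABLE
  once D2/D3 exist.
* `stub_halfPlecticTransfer : HalfPlecticInstruments → PartnerPrimeSupply → K1‴` — the typed carrier of (α)+(β)+(γ).  **COSTUME at the typed level**
  (given P1 it is K1‴ by name — today's vocabulary cannot see `θ_L` or the transverse height); its content is items 2–6 above.
* `stub_ksTwinLambda` = K2a‴ BY NAME (WEAKER·port, beta_road), `stub_goodSS` = C₀′ BY NAME (bucket C₀ frame, beta_road).
* BARRIER leaf: `AnticyclotomicHeightDegeneracy` — inside its technique class, hypothesis (odd rank) FAILS by construction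
  (`gram_balanced`); `ExceptionalZero` — the transverse logarithm kills the Tate period (item 6); `NoAdmissiblePrimesAtThree`
  (Disproof lane) — not touched: no admissible or level-raising prime is used.

## WHY NOVEL (vs rows 1–26 and the dead levers)

The `μ`-input is the mod-3 multiplicity of a SIGN-FORCED exceptional divisor (`u = γ_{K′} − 1`) of a discriminant-one definite
theta element that exists only because `[F:ℚ]` is even, read through a THIRD `ℤ₃`-direction (`Γ_{K′}`, visible only over `L`)
whose leading coefficient is a CROSS-height between `E′` and its partner twist.  No row uses a third `ℤ₃`-direction, a definite
algebra without auxiliary primes, or a cross-height: rows 13/20 change the reduction type by RAMIFIED base change (here `F/ℚ` is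
unramified at `3N′`, a parity device only); row 25 needs bisigned Kolyvagin/admissible primes (dead: `NoAdmissiblePrimesAtThree`,
"no Shimura-free bipartite upper bound"); the dead «`KK′`/biquadratic coupling» wanted an ALGEBRAIC `μ` upstairs (inaccessible) —
here the upstairs object is ANALYTIC and definite (Vatsal-class `μ`-theorems available) and the way down is a reciprocity law, not
a `μ`-coupling; the dead «`ℤ₃²`/Kato/cyclotomic-transverse» direction is replaced by a `K′`-ANTICYCLOTOMIC transverse direction;
«CV global indivisibility» kills only the global `μ(M)`, whereas (γ) lands on the LOCAL statement K1‴.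

## DISPROOF USED
Honours `twinAlgMuZeroAtThree_false_without_heegner`: Heegner for `N′` is used twice — in the sign computation of item 3
(all `q ∣ N′` split in `K` ⇒ definite family over `L` with exceptional `K`-line) and for the existence of `z_∞(E′)`; `ℓ` split
in `K` makes `K` Heegner for `N′ℓ²` (family of the twist).  No refuted strengthening (`…Strong`, `…WithoutSurj`, …) is implied:
the output is exactly K1‴.

[cite: BertoliniDarmon1996, §2.5] [cite: CornutVatsal2007, Thm. 1.10, Thm. 4.1] [cite: Howard2004HeegnerKolyvagin, §3.3]
[cite: BertoliniDarmon1995, §3.1 Lemma 3.1] [cite: Nekovar2006Selmer, §11] [cite: DarmonFornea2025MockPlectic, §3.5, §3.8]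
[cite: ForneaGehrmann2023Plectic, §4] [cite: Disegni2022UniversalGZ, Thm. A]
-/

/-! ## §0 Instruments (sorry-free, mechanism-specific finite algebra) -/

namespace Summit.BirchSwinnertonDyer.BirchSwinnertonDyer.Cruxes.TwinAlgMuZeroAtThree.HalfPlecticTransverse.Instrument

/-- Multiplication by `u = γ − 1` on `𝔽₃[C₃] = 𝔽₃[γ]/(γ³ − 1)` in the basis `1, γ, γ²` (one `K`-cell, three `K′`-cells):
`(b₀, b₁, b₂) ↦ (b₂ − b₀, b₀ − b₁, b₁ − b₂)`. [folklore] -/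
def uMul (b : Fin 3 → ZMod 3) : Fin 3 → ZMod 3 := ![b 2 - b 0, b 0 - b 1, b 1 - b 2]

/-- **The `K`-line is exceptional iff the cell sums to zero**: `a ∈ u·𝔽₃[C₃]` iff `a₀ + a₁ + a₂ = 0` (push-forward to
`Γ_K` vanishes). [folklore] -/
theorem mem_aug_iff : ∀ a : Fin 3 → ZMod 3, (∃ b, a = uMul b) ↔ a 0 + a 1 + a 2 = 0 := by
  decide

/-- **Transverse order ≥ 2 iff the three `K′`-cells are congruent**: `a ∈ u²·𝔽₃[C₃]` iff `a₀ = a₁ = a₂`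
(`u² ≡ 1 + γ + γ²` mod `3`). [folklore] -/
theorem mem_aug_sq_iff : ∀ a : Fin 3 → ZMod 3, (∃ b, a = uMul (uMul b)) ↔ (a 0 = a 1 ∧ a 1 = a 2) := by
  decide

/-- **(α) at one cell, decidable form**: exact transverse multiplicity one (`a ∈ (u) ∖ (u²)`) iff the cell sums to `0`
mod `3` but its three `K′`-sub-sums are NOT all congruent mod `3` — the statement a Brandt-module computation over `F` tests.
[folklore] -/
theorem transverse_mult_one_iff (a : Fin 3 → ZMod 3) :
    ((∃ b, a = uMul b) ∧ ¬ ∃ b, a = uMul (uMul b)) ↔ (a 0 + a 1 + a 2 = 0 ∧ ¬ (a 0 = a 1 ∧ a 1 = a 2)) := by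
  rw [mem_aug_iff a, mem_aug_sq_iff a]

open Literature.Barriers.BirchSwinnertonDyer in
/-- **Balanced parity defeats the anticyclotomic degeneracy mechanism.**  For a pairing `B` anti-equivariant under `τ`
(`IsAntiEquivariant`, the barrier's technique class, Bertolini–Darmon 1995 Lemma 3.1) and a BALANCED pair `x ∈ M^{τ=+1}`,
`y ∈ M^{τ=−1}`: the diagonal entries vanish and the `2 × 2` Gram determinant is `−(B x y)(B y x)` — no forced zero; it
vanishes iff a cross term does.  (Contrast `det_gramMatrix_eq_zero_of_odd`: odd rank ⇒ determinant `0`.)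
[cite: BertoliniDarmon1995, §3.1 Lemma 3.1] -/
theorem gram_balanced {M R : Type*} [AddCommGroup M] [CommRing R] [NoZeroDivisors R] (h2 : (2 : R) ≠ 0)
    {B : M →+ M →+ R} {τ : M →+ M} (hB : IsAntiEquivariant B τ) {x y : M} (hx : τ x = x) (hy : τ y = -y) :
    B x x = 0 ∧ B y y = 0 ∧ (gramMatrix B ![x, y]).det = -(B x y * B y x) := by
  have hxx : B x x = 0 := by
    have h := hB x x
    rw [hx] at h
    have h' : (2 : R) * B x x = 0 := by linear_combination h
    exact (mul_eq_zero.mp h').resolve_left h2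
  have hyy : B y y = 0 := by
    have h := hB y y
    rw [hy] at h
    simp only [map_neg, AddMonoidHom.neg_apply, neg_neg] at h
    have h' : (2 : R) * B y y = 0 := by linear_combination h
    exact (mul_eq_zero.mp h').resolve_left h2
  refine ⟨hxx, hyy, ?_⟩
  rw [Matrix.det_fin_two]
  simp [gramMatrix_apply, hxx, hyy]

/-- A finite sum of non-unit `3`-adic integers is a non-unit (ultrametric pigeonhole, contrapositive form used by (γ)).
[folklore] -/
theorem norm_sum_lt_one {ι : Type*} (s : Finset ι) (f : ι → ℤ_[3]) (h : ∀ i ∈ s, ‖f i‖ < 1) :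
    ‖∑ i ∈ s, f i‖ < 1 := by
  rw [PadicInt.norm_lt_one_iff_dvd]
  exact Finset.dvd_sum fun i hi => (PadicInt.norm_lt_one_iff_dvd _).mp (h i hi)

/-- **Unit sum ⇒ some unit term.** [folklore] -/
theorem exists_norm_eq_one_of_norm_sum_eq_one {ι : Type*} (s : Finset ι) (f : ι → ℤ_[3])
    (h : ‖∑ i ∈ s, f i‖ = 1) : ∃ i ∈ s, ‖f i‖ = 1 := by
  by_contra hne
  push Not at hne
  have hlt : ‖∑ i ∈ s, f i‖ < 1 :=
    norm_sum_lt_one s f fun i hi => lt_of_le_of_ne (PadicInt.norm_le_one _) (hne i hi)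
  exact absurd h (ne_of_lt hlt)

/-- **Bilinear + integral ⇒ a locally `3`-divisible point pairs into `3ℤ₃`.** [folklore] -/
theorem norm_lt_one_of_three_smul {M N : Type*} [AddCommGroup M] [AddCommGroup N] (B : M →+ N →+ ℤ_[3])
    (P' : M) (Q : N) : ‖B ((3 : ℤ) • P') Q‖ < 1 := by
  rw [map_zsmul, AddMonoidHom.zsmul_apply, zsmul_eq_mul, PadicInt.norm_lt_one_iff_dvd]
  exact ⟨B P' Q, by push_cast; ring⟩

/-- **(γ) LOCAL EXTRACTION PRINCIPLE (algebraic skeleton).**  If a `ℤ₃`-valued height of `(P, Q)` is a finite sum of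
bilinear LOCAL terms `B_w (P_w) Q` over places `w ∈ s` and the total is a `3`-adic unit, then at some `w ∈ s` the local
component `P_w` is not `3·`(a local point).  In the line: `s` = the primes of `L K_k` above `3`, `P_w = loc_w z_k`,
`Q = g · y_k`; conclusion = K1‴'s local indivisibility. [folklore] -/
theorem local_extraction {ι M N : Type*} [AddCommGroup M] [AddCommGroup N] (s : Finset ι)
    (B : ι → (M →+ N →+ ℤ_[3])) (P : ι → M) (Q : N) (hunit : ‖∑ w ∈ s, B w (P w) Q‖ = 1) :
    ∃ w ∈ s, ∀ P' : M, P w ≠ (3 : ℤ) • P' := by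
  obtain ⟨w, hw, hw1⟩ := exists_norm_eq_one_of_norm_sum_eq_one s (fun w ↦ B w (P w) Q) hunit
  refine ⟨w, hw, fun P' hP ↦ ?_⟩
  have hlt := norm_lt_one_of_three_smul (B w) P' Q
  rw [← hP] at hlt
  exact absurd hw1 (ne_of_lt hlt)

open Literature.Barriers.BirchSwinnertonDyer in
/-- **The node's instrument bundle** (closed form of `transverse_mult_one_iff`, `gram_balanced`, `local_extraction`), fed
to the transfer stub so that the kernel-checked finite content of (α), (β), (γ) sits in the cone of the composition.
[folklore] -/
def HalfPlecticInstruments : Prop :=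
  (∀ a : Fin 3 → ZMod 3,
      ((∃ b, a = uMul b) ∧ ¬ ∃ b, a = uMul (uMul b)) ↔ (a 0 + a 1 + a 2 = 0 ∧ ¬ (a 0 = a 1 ∧ a 1 = a 2))) ∧
  (∀ (M R : Type) [AddCommGroup M] [CommRing R] [NoZeroDivisors R], (2 : R) ≠ 0 →
      ∀ (B : M →+ M →+ R) (τ : M →+ M), IsAntiEquivariant B τ → ∀ x y : M, τ x = x → τ y = -y →
        B x x = 0 ∧ B y y = 0 ∧ (gramMatrix B ![x, y]).det = -(B x y * B y x)) ∧
  (∀ (ι M N : Type) [AddCommGroup M] [AddCommGroup N] (s : Finset ι) (B : ι → (M →+ N →+ ℤ_[3]))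
      (P : ι → M) (Q : N), ‖∑ w ∈ s, B w (P w) Q‖ = 1 → ∃ w ∈ s, ∀ P' : M, P w ≠ (3 : ℤ) • P')

/-- The instrument bundle holds (sorry-free). [folklore] -/
theorem halfPlecticInstruments : HalfPlecticInstruments :=
  ⟨transverse_mult_one_iff,
    fun _ _ _ _ _ h2 _ _ hB _ _ hx hy ↦ gram_balanced h2 hB hx hy,
    fun _ _ _ _ _ s B P Q h ↦ local_extraction s B P Q h⟩

end Summit.BirchSwinnertonDyer.BirchSwinnertonDyer.Cruxes.TwinAlgMuZeroAtThree.HalfPlecticTransverse.Instrument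

/-! ## §1 The pieces -/

open scoped Classical Pointwise ContRepresentation TensorProduct NumberField

namespace Summit.BirchSwinnertonDyer.BirchSwinnertonDyer.Cruxes.TwinAlgMuZeroAtThree.HalfPlecticTransverse

open NumberField IsDedekindDomain Field WeierstrassCurve
open Literature.NumberTheory.EllipticCurves Literature.NumberTheory.EllipticCurves.GreenbergSelmer
open Summit.BirchSwinnertonDyer.Rank1Residual.X11b Summit.BirchSwinnertonDyer.Rank1Residual.X11b.AcSelmer
open Summit.BirchSwinnertonDyer.BirchSwinnertonDyer.Theorems
open Summit.BirchSwinnertonDyer.BirchSwinnertonDyer.Theorems.UniversalToricDescentTwinAlgMuZeroAtThreeOfBetaRoadParam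
open Literature.NumberTheory.EllipticCurves.ZpExtension
open Literature.NumberTheory.EllipticCurves.ModularForms (ModularParametrizationData heegnerPointComplexOfConductor)

/-- **P1 · PARTNER PRIME SUPPLY** (typed, PROVED below).  For every level `N ≠ 0` and every odd `D` with `3 ∤ D` (in the
line: `D = d_K`, odd by the crux binder `Odd (discr K)`, prime to `3` because `3 = 𝔭𝔭′` splits) there is a prime `ℓ` with
`ℓ ≡ 5 (mod 12)` (so `disc ℚ(√ℓ) = ℓ` and `3` is INERT in `F = ℚ(√ℓ)`), `ℓ ∤ N`, `ℓ ∤ D` (so `F/ℚ` is unramified at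
`3 N D` and the twist `E′^{(ℓ)}` keeps the reduction type at `3`), and `(D/ℓ) = 1` (so `ℓ` SPLITS in `K = ℚ(√D)`: `K` is
Heegner for `N ℓ²`).  Dirichlet's theorem on primes in progressions + CRT + periodicity of the Jacobi symbol.
[folklore] -/
def PartnerPrimeSupply : Prop :=
  ∀ (N : ℕ) (D : ℤ), N ≠ 0 → Odd D → ¬ (3 : ℤ) ∣ D →
    ∃ ℓ : ℕ, ℓ.Prime ∧ ¬ ℓ ∣ N ∧ ¬ (ℓ : ℤ) ∣ D ∧ ℓ % 12 = 5 ∧ jacobiSym D ℓ = 1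

/-- P1 holds. [folklore] -/
theorem partnerPrimeSupply : PartnerPrimeSupply := by
  intro N D hN hD h3
  have hD0 : D ≠ 0 := by
    rintro rfl
    exact absurd (Int.odd_iff.mp hD) (by decide)
  set d : ℕ := D.natAbs with hd
  have hd0 : d ≠ 0 := Int.natAbs_ne_zero.mpr hD0
  have hdodd : Odd d := Int.natAbs_odd.mpr hD
  have hd3 : ¬ 3 ∣ d := fun h ↦ h3 (by exact_mod_cast (Int.natCast_dvd.mpr h : ((3 : ℕ) : ℤ) ∣ D))
  have hd2 : d % 2 = 1 := Nat.odd_iff.mp hdodd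
  have hd3' : d % 3 = 1 ∨ d % 3 = 2 := by omega
  obtain ⟨e, he⟩ : ∃ e, d * d = e := ⟨_, rfl⟩
  have he3 : e % 3 = 1 := by
    rw [← he, Nat.mul_mod]
    rcases hd3' with h | h <;> simp [h]
  set a : ℕ := 1 + 4 * d * d with ha
  have hae : a = 1 + 4 * e := by rw [ha, ← he]; ring
  have ha12 : a % 12 = 5 := by omega
  have hcop : Nat.Coprime a (12 * d) := by
    apply Nat.Coprime.mul_right
    · rw [Nat.Coprime, Nat.gcd_comm, Nat.gcd_rec, ha12]
      decide
    · have : a = 1 + d * (4 * d) := by rw [ha]; ring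
      rw [this]
      exact (Nat.coprime_add_mul_left_left 1 d (4 * d)).mpr (Nat.coprime_one_left d)
  haveI : NeZero (12 * d) := ⟨mul_ne_zero (by norm_num) hd0⟩
  have hunit : IsUnit ((a : ℕ) : ZMod (12 * d)) := (ZMod.isUnit_iff_coprime a (12 * d)).mpr hcop
  obtain ⟨ℓ, hℓgt, hℓp, hℓa⟩ := Nat.forall_exists_prime_gt_and_eq_mod hunit (N + d + 2)
  have hmod : ℓ ≡ a [MOD 12 * d] := (ZMod.natCast_eq_natCast_iff _ _ _).mp hℓa
  have hℓodd : Odd ℓ := hℓp.odd_of_ne_two (by omega)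
  refine ⟨ℓ, hℓp, ?_, ?_, ?_, ?_⟩
  · intro h
    have := Nat.le_of_dvd (Nat.pos_of_ne_zero hN) h
    omega
  · intro h
    have := Nat.le_of_dvd (Nat.pos_of_ne_zero hd0) (Int.natCast_dvd.mp h)
    omega
  · have h12 : ℓ ≡ a [MOD 12] := hmod.of_mul_right d
    unfold Nat.ModEq at h12
    omega
  · have h4 : ℓ ≡ a [MOD 4 * d] := by
      have h' : 12 * d = 3 * (4 * d) := by ring
      rw [h'] at hmod
      exact hmod.of_mul_left 3
    have ha4 : a % (4 * d) = 1 := by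
      rw [ha, Nat.add_mul_mod_self_left, Nat.mod_eq_of_lt (by omega)]
    have hℓ4 : ℓ % (4 * d) = 1 := by
      unfold Nat.ModEq at h4
      rw [h4, ha4]
    rw [jacobiSym.mod_right D hℓodd, ← hd, hℓ4, jacobiSym.one_right]

/-- **HALF-PLECTIC TRANSFER** (stub; the typed carrier of (α) + (β) + (γ) of the module docstring; **COSTUME at the typed
level** — given P1 it is K1‴ by name, because the tree has no vocabulary yet for Gross points over a totally real field (D1),
Nekovář heights in a general `ℤ_p`-direction (D2) or `ℓ`-local height symbols at split multiplicative primes (D3); the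
research content is: the partner prime `ℓ` of P1 ↦ `F = ℚ(√ℓ)`, `L = K F`, the discriminant-one totally definite theta
element `θ_L ∈ ℤ₃⟦Γ_K × Γ_{K′}⟧`, its `K`-line exceptional divisor `u = γ_{K′} − 1` (Artin formalism, both `K`-factors of
sign `−1`), (α) `μ(θ_L^{(1)}) = 0` for `θ_L^{(1)} = (θ_L/u)|_{Γ_K}` [finite-layer form `Instrument.transverse_mult_one_iff`],
(β) `θ_L^{(1)} ≐` the `K′`-direction `Λ_K`-adic height of the Heegner family of `E′` against that of `E′^{(ℓ)}` [balanced
parity, `Instrument.gram_balanced`], (γ) `μ = 0` of that height ⇒ a `3`-adic-unit `𝔭`-side local term at some layer ⇒ K1‴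
[`Instrument.local_extraction`]).  Why it might fail: (α) needs a Cornut–Vatsal/Vatsal theorem over `F` at `p = 3 ∥ 𝔑`
whose TRANSVERSE (not merely generic-character) form is unprinted; (β) is an unprinted reciprocity law (two-variable definite
family ↔ cross-height of two indefinite families), nearest print Bertolini–Darmon `θ′ = y_K` and mock plectic invariants.
[cite: BertoliniDarmon1996, §2.5] [cite: CornutVatsal2007, Thm. 1.10] [cite: Nekovar2006Selmer, §11]
[cite: DarmonFornea2025MockPlectic, §3.5] -/
theorem stub_halfPlecticTransfer :
    Instrument.HalfPlecticInstruments → PartnerPrimeSupply →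
      UniversalToricDescentBetaRoadParamDefs.PrincipalHeegnerIndivisibleMultOfParamAtThree := by
  sorry

/-- **stub_ksTwinLambda** (K2a‴, BY NAME from beta_road v19; WEAKER·port — the `Λ`-adic Kolyvagin-system engine).
[cite: Howard2004HeegnerKolyvagin, Thm. 2.2.10, §3.3–3.4] -/
theorem stub_ksTwinLambda : UniversalToricDescentKsTwinLambdaDefs.KsTwinLambdaAdicAtThree := by
  sorry

/-- **stub_goodSS** (C₀′, BY NAME from beta_road v19; the signed frame, untouched by this node).
[cite: BurungaleCastellaSkinner2025, Thm. 4.2.1 (b) (shape only)] -/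
theorem stub_goodSS : UniversalToricDescentBetaRoadParamDefs.TwinAlgMuZeroAtThreeGoodSSOfParam := by
  sorry

/-! ## §2 Composition (sorry-free below this line) -/

/-- K1‴ from the half-plectic supplier: the proved partner supply P1 fed into the transfer. -/
theorem principalHeegnerIndivisibleMult_of_halfPlectic
    (hT : Instrument.HalfPlecticInstruments → PartnerPrimeSupply →
      UniversalToricDescentBetaRoadParamDefs.PrincipalHeegnerIndivisibleMultOfParamAtThree) :
    UniversalToricDescentBetaRoadParamDefs.PrincipalHeegnerIndivisibleMultOfParamAtThree :=
  hT Instrument.halfPlecticInstruments partnerPrimeSupply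

/-- **The crux BY NAME from the node's pieces** (arrow form): instruments → P1 → (instruments → P1 → K1‴) → K2a‴ → C₀′ → crux, through the LEAD
composition `twinAlgMuZeroAtThree_of_betaRoadParamStubs` (beta_road v19). -/
theorem TwinAlgMuZeroAtThree_of :
    Instrument.HalfPlecticInstruments → PartnerPrimeSupply →
    (Instrument.HalfPlecticInstruments → PartnerPrimeSupply →
      UniversalToricDescentBetaRoadParamDefs.PrincipalHeegnerIndivisibleMultOfParamAtThree) →
    UniversalToricDescentKsTwinLambdaDefs.KsTwinLambdaAdicAtThree →
    UniversalToricDescentBetaRoadParamDefs.TwinAlgMuZeroAtThreeGoodSSOfParam →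
    Summit.BirchSwinnertonDyer.BirchSwinnertonDyer.Theses.UniversalToricDescent.TwinAlgMuZeroAtThree :=
  fun hI hP1 hT hK2 hC0 ↦ twinAlgMuZeroAtThree_of_betaRoadParamStubs (hT hI hP1) hK2 hC0

/-- **The crux BY NAME** (closed form, from the registered stubs of this file). -/
theorem TwinAlgMuZeroAtThree_of_stubs :
    Summit.BirchSwinnertonDyer.BirchSwinnertonDyer.Theses.UniversalToricDescent.TwinAlgMuZeroAtThree :=
  TwinAlgMuZeroAtThree_of Instrument.halfPlecticInstruments partnerPrimeSupply stub_halfPlecticTransfer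
    stub_ksTwinLambda stub_goodSS

end Summit.BirchSwinnertonDyer.BirchSwinnertonDyer.Cruxes.TwinAlgMuZeroAtThree.HalfPlecticTransverse
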